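import Summits.Ventures.CertifiedManyBodySolver.Theorems.TcThermcert1HighTempRootedAnimals
import HarnessLib

/-!
# High-temperature current clustering for TcThermcert1's Hypothesis C — part 2c: the cluster sum

Helper file for route `TcThermcert1` (crux K1′ `ThermalStiffnessCeilingU8b8_le_7o44`, item `stmt-Ventures-24560`; line
`Cruxes/ThermalStiffnessCeilingU8b8_le_7o44/Lines/gauge_qbp_far_seam.lean`, small-`β` rung `stub_currentClustering8_smallBeta`).
Pure combinatorics (cells `V` with vertex sets `verts : V → Finset α`, roots `a, b`), continuing parts 2a–2b:

* `sum_insert_empty_rooted_le`: the rooted animal sum with the empty set adjoined, `Σ_{Y ∈ {∅} ∪ 𝒴_x} s^{|Y|} ≤ 1 + m·2s`;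
* **`sum_admissible_reaching_pow_le` — THE CLUSTER SUM**: for `0 ≤ λ ≤ λ₁ ≤ 1`, `(Δ+1)² √λ₁ ≤ 1/2` (`Δ` a bound on the
  `ShareVertex`-neighbour lists, `m` a bound on the number of cells through a root), a "distance" `D` with `D x x = 0`, the triangle
  inequality and cells of `D`-diameter `≤ 1`, and a site set `X` at `D`-distance `≥ d` from both roots:
  `Σ_{K ⊆ P admissible, reaching X} λ^{|K|} ≤ (λ/λ₁)^d · (1 + m·2√λ₁)²`
  (every such `K` has `≥ d` cells; an admissible `K` is the union of its two rooted reachable families, each empty or a rooted animal,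
  and `λ₁^{|K|} ≤ √λ₁^{|K_a|} √λ₁^{|K_b|}`).

[cite: FriedliVelenik2017, §5.2 and eq. (5.27)]; [cite: Ueltschi1999, §2.3]. No physics; no definitions; no `sorry`. Nothing here bears on
`T_c` or on superconductivity in the Hubbard model.
-/

namespace Summit.Ventures.CertifiedManyBodySolver.Theorems.TcThermcert1.HighTempCurrentClustering

open Finset
open Literature.Probability.LatticeModels
open scoped Classical

variable {α V : Type*} [DecidableEq α] [DecidableEq V] {verts : V → Finset α}

/-- The rooted animal sum with the empty set adjoined: `Σ_{Y ∈ {∅} ∪ 𝒴_x} s^{|Y|} ≤ 1 + m·2s`. [cite: FriedliVelenik2017, eq. (5.27)] -/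
theorem sum_insert_empty_rooted_le {nbr : V → Finset V} {Δ : ℕ} (hΔ : ∀ Z, (nbr Z).card ≤ Δ)
    (hnbr : ∀ Z Z', ShareVertex verts Z Z' → Z' ∈ nbr Z) {s : ℝ} (hs : 0 ≤ s)
    (hsmall : ((Δ : ℝ) + 1) ^ 2 * s ≤ 1 / 2) (x : α) (P : Finset V) {m : ℕ} (hm : (P.filter fun Z => x ∈ verts Z).card ≤ m) :
    ∑ Y ∈ insert ∅ (P.powerset.filter (fun Y => IsRConnected (ShareVertex verts) Y ∧ ∃ Z ∈ Y, x ∈ verts Z)), s ^ Y.card ≤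
      1 + m * (2 * s) := by
  have hne : (∅ : Finset V) ∉ P.powerset.filter (fun Y => IsRConnected (ShareVertex verts) Y ∧ ∃ Z ∈ Y, x ∈ verts Z) := fun h => by
    obtain ⟨-, -, Z, hZ, -⟩ := Finset.mem_filter.1 h
    exact Finset.notMem_empty Z hZ
  rw [Finset.sum_insert hne, Finset.card_empty, pow_zero]
  gcongr
  exact sum_pow_card_rooted_le hΔ hnbr hs hsmall x P hm

/-- **The cluster sum.** With `ShareVertex`-neighbour lists of size `≤ Δ`, at most `m` cells of `P` through each root, `0 ≤ λ ≤ λ₁ ≤ 1`,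
`(Δ+1)² √λ₁ ≤ 1/2`, a "distance" `D` (zero on the diagonal, triangle inequality, cells of diameter `≤ 1`) and `X` at `D`-distance `≥ d` from
both roots `a, b`: `Σ_{K ⊆ P admissible, reaching X} λ^{|K|} ≤ (λ/λ₁)^d · (1 + m·2√λ₁)²`. [cite: FriedliVelenik2017, §5.2] -/
theorem sum_admissible_reaching_pow_le {nbr : V → Finset V} {Δ : ℕ} (hΔ : ∀ Z, (nbr Z).card ≤ Δ)
    (hnbr : ∀ Z Z', ShareVertex verts Z Z' → Z' ∈ nbr Z)
    (D : α → α → ℕ) (hD0 : ∀ x, D x x = 0) (htri : ∀ x y z, D x z ≤ D x y + D y z)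
    (hdiam : ∀ Z : V, ∀ y ∈ verts Z, ∀ y' ∈ verts Z, D y y' ≤ 1)
    (P : Finset V) (a b : α) {m : ℕ} (hma : (P.filter fun Z => a ∈ verts Z).card ≤ m) (hmb : (P.filter fun Z => b ∈ verts Z).card ≤ m)
    {X : Finset α} {d : ℕ} (hd : ∀ x ∈ X, d ≤ D a x ∧ d ≤ D b x)
    {lam lam₁ : ℝ} (h0 : 0 ≤ lam) (h1 : lam ≤ lam₁) (hlam₁ : lam₁ ≤ 1)
    (hsmall : ((Δ : ℝ) + 1) ^ 2 * Real.sqrt lam₁ ≤ 1 / 2) :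
    ∑ K ∈ P.powerset.filter (fun K => (∀ Z ∈ K, ∃ w ∈ verts Z, ∃ r ∈ ({a, b} : Finset α),
          Relation.ReflTransGen (fun x y : α => ∃ Z ∈ K, x ∈ verts Z ∧ y ∈ verts Z) r w) ∧
          ∃ x ∈ X, ∃ r ∈ ({a, b} : Finset α),
            Relation.ReflTransGen (fun x y : α => ∃ Z ∈ K, x ∈ verts Z ∧ y ∈ verts Z) r x), lam ^ K.card ≤
      (lam / lam₁) ^ d * (1 + m * (2 * Real.sqrt lam₁)) ^ 2 := by
  have hlam₁0 : 0 ≤ lam₁ := h0.trans h1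
  set s := Real.sqrt lam₁ with hs
  have hs0 : 0 ≤ s := Real.sqrt_nonneg _
  have hs1 : s ≤ 1 := (Real.sqrt_le_sqrt hlam₁).trans_eq Real.sqrt_one
  have hss : s * s = lam₁ := Real.mul_self_sqrt hlam₁0
  -- the rooted animal families (with `∅` adjoined), the splitting map, the admissible family
  set 𝒴 : α → Finset (Finset V) := fun x => insert ∅ (P.powerset.filter
    (fun Y => IsRConnected (ShareVertex verts) Y ∧ ∃ Z ∈ Y, x ∈ verts Z)) with h𝒴
  set φ : Finset V → Finset V × Finset V := fun K =>
    (K.filter (fun Z => ∃ w ∈ verts Z, Relation.ReflTransGen (fun x y : α => ∃ Z ∈ K, x ∈ verts Z ∧ y ∈ verts Z) a w),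
      K.filter (fun Z => ∃ w ∈ verts Z, Relation.ReflTransGen (fun x y : α => ∃ Z ∈ K, x ∈ verts Z ∧ y ∈ verts Z) b w)) with hφ
  set Adm := P.powerset.filter (fun K => ∀ Z ∈ K, ∃ w ∈ verts Z, ∃ r ∈ ({a, b} : Finset α),
      Relation.ReflTransGen (fun x y : α => ∃ Z ∈ K, x ∈ verts Z ∧ y ∈ verts Z) r w) with hAdm
  -- step 1: every admissible `K` reaching `X` has at least `d` cells
  have step1 : ∑ K ∈ P.powerset.filter (fun K => (∀ Z ∈ K, ∃ w ∈ verts Z, ∃ r ∈ ({a, b} : Finset α),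
          Relation.ReflTransGen (fun x y : α => ∃ Z ∈ K, x ∈ verts Z ∧ y ∈ verts Z) r w) ∧
          ∃ x ∈ X, ∃ r ∈ ({a, b} : Finset α),
            Relation.ReflTransGen (fun x y : α => ∃ Z ∈ K, x ∈ verts Z ∧ y ∈ verts Z) r x), lam ^ K.card ≤
      ∑ K ∈ Adm, (lam / lam₁) ^ d * lam₁ ^ K.card := by
    rw [← Finset.filter_filter]
    refine (Finset.sum_le_sum fun K hK => ?_).trans
      (Finset.sum_le_sum_of_subset_of_nonneg (Finset.filter_subset _ _) fun K _ _ => by positivity)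
    obtain ⟨-, x, hx, hrx⟩ := Finset.mem_filter.1 hK
    have hdK : d ≤ K.card := by
      obtain ⟨r, hr, hrD⟩ := exists_root_dist_le_card D hD0 htri hdiam hrx
      rcases Finset.mem_insert.1 hr with rfl | hr
      · exact (hd x hx).1.trans hrD
      · rw [Finset.mem_singleton.1 hr] at hrD
        exact (hd x hx).2.trans hrD
    by_cases hl1 : lam₁ = 0
    · have hl : lam = 0 := le_antisymm (hl1 ▸ h1) h0
      rcases Nat.eq_zero_or_pos K.card with hK0 | hKpos
      · have hd0 : d = 0 := Nat.eq_zero_of_le_zero (hK0 ▸ hdK)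
        simp [hK0, hd0]
      · rw [hl, zero_pow hKpos.ne']
        positivity
    · have hl1pos : 0 < lam₁ := lt_of_le_of_ne hlam₁0 (Ne.symm hl1)
      have hq1 : lam / lam₁ ≤ 1 := (div_le_one hl1pos).2 h1
      have hq0 : 0 ≤ lam / lam₁ := div_nonneg h0 hlam₁0
      calc lam ^ K.card = (lam / lam₁) ^ K.card * lam₁ ^ K.card := by rw [← mul_pow, div_mul_cancel₀ _ hl1]
        _ ≤ (lam / lam₁) ^ d * lam₁ ^ K.card :=
            mul_le_mul_of_nonneg_right (pow_le_pow_of_le_one hq0 hq1 hdK) (pow_nonneg hlam₁0 _)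
  refine step1.trans ?_
  rw [← Finset.mul_sum]
  gcongr
  -- step 2: `λ₁^{|K|} ≤ s^{|K_a|} s^{|K_b|}` and injectivity of `K ↦ (K_a, K_b)` on admissible `K`
  have hw : ∀ K ∈ Adm, lam₁ ^ K.card ≤ s ^ (φ K).1.card * s ^ (φ K).2.card := by
    intro K _
    rw [← pow_add, ← hss, ← pow_two, ← pow_mul]
    refine pow_le_pow_of_le_one hs0 hs1 ?_
    have h1 : (φ K).1.card ≤ K.card := Finset.card_le_card (Finset.filter_subset _ K)
    have h2 : (φ K).2.card ≤ K.card := Finset.card_le_card (Finset.filter_subset _ K)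
    omega
  have hinj : Set.InjOn φ ↑Adm := by
    intro K hK K' hK' hKK'
    have hKu := eq_union_reachCells_of_admissible (verts := verts) (Finset.mem_filter.1 (Finset.mem_coe.1 hK)).2
    have hK'u := eq_union_reachCells_of_admissible (verts := verts) (Finset.mem_filter.1 (Finset.mem_coe.1 hK')).2
    have h := congrArg (fun q : Finset V × Finset V => q.1 ∪ q.2) hKK'
    exact (hKu.trans h).trans hK'u.symm
  have himg : Adm.image φ ⊆ 𝒴 a ×ˢ 𝒴 b := by
    intro q hq
    obtain ⟨K, hK, rfl⟩ := Finset.mem_image.1 hq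
    have hKP : K ⊆ P := Finset.mem_powerset.1 (Finset.mem_filter.1 hK).1
    refine Finset.mem_product.2 ⟨?_, ?_⟩
    · rcases reachCells_eq_empty_or_mem (verts := verts) hKP a with h | h
      · exact Finset.mem_insert.2 (Or.inl h)
      · exact Finset.mem_insert_of_mem h
    · rcases reachCells_eq_empty_or_mem (verts := verts) hKP b with h | h
      · exact Finset.mem_insert.2 (Or.inl h)
      · exact Finset.mem_insert_of_mem h
  calc ∑ K ∈ Adm, lam₁ ^ K.card ≤ ∑ K ∈ Adm, s ^ (φ K).1.card * s ^ (φ K).2.card := Finset.sum_le_sum hw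
    _ = ∑ q ∈ Adm.image φ, s ^ q.1.card * s ^ q.2.card :=
        (Finset.sum_image (f := fun q : Finset V × Finset V => s ^ q.1.card * s ^ q.2.card) hinj).symm
    _ ≤ ∑ q ∈ 𝒴 a ×ˢ 𝒴 b, s ^ q.1.card * s ^ q.2.card :=
        Finset.sum_le_sum_of_subset_of_nonneg himg fun q _ _ => by positivity
    _ = (∑ Y ∈ 𝒴 a, s ^ Y.card) * (∑ Y ∈ 𝒴 b, s ^ Y.card) := by rw [Finset.sum_product, Finset.sum_mul_sum]
    _ ≤ (1 + m * (2 * s)) * (1 + m * (2 * s)) := by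
        have ha := sum_insert_empty_rooted_le hΔ hnbr hs0 hsmall a P hma
        have hb := sum_insert_empty_rooted_le hΔ hnbr hs0 hsmall b P hmb
        have ha0 : 0 ≤ ∑ Y ∈ 𝒴 a, s ^ Y.card := Finset.sum_nonneg fun Y _ => pow_nonneg hs0 _
        exact mul_le_mul ha hb (Finset.sum_nonneg fun Y _ => pow_nonneg hs0 _) (ha0.trans ha)
    _ = (1 + m * (2 * Real.sqrt lam₁)) ^ 2 := by rw [hs, pow_two]

end Summit.Ventures.CertifiedManyBodySolver.Theorems.TcThermcert1.HighTempCurrentClustering
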